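import Summits.BirchSwinnertonDyer.BirchSwinnertonDyer.Theorems.SchneiderFreeAdditiveX3OrdinaryLineCharacter
import Summits.BirchSwinnertonDyer.BirchSwinnertonDyer.Theorems.SchneiderFreeAdditiveX3LineCharacterBaseChange
import Literature.NumberTheory.EllipticCurves.AnticyclotomicLocalNormResidueSymbolProofs
import Literature.NumberTheory.EllipticCurves.ComplexMultiplicationDeuringFrobeniusProofs
import HarnessLib

/-!
# Fin_v for a GOOD ORDINARY curve over `ℚ` on the anticyclotomic tower at a split prime
# (route `UniversalToricDescent`, crux ♭T′ stmt-BirchSwinnertonDyer-26975 `DefectTransportModThreePT`,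
# residue (R2) of the algebraic half `stub_lambdaTransportPT`; seat `bsd-wall-utd-p1` gen 13)

The (iv)-free λ-transport along `E[3] ≅ E′[3]` (`…DefectTransportNoLocalHypothesis`,
`defectTransport_algebraicHalf_lambda_of_wall_of_twinBaseFinite`) consumes, for the non-additive twin
`E′`, the local tower torsion finiteness `LocalTowerTorsionFiniteAt (E′_K) 3 κ 𝔭′`:
`E′(K̄)[3^∞]^{D_𝔭′ ⊓ Gal(K̄/K_∞)}` is finite.  For a good supersingular, split multiplicative or non-split
multiplicative twin this is a tree theorem or (L)-trivial; this file proves it for a GOOD ORDINARY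
curve `W/ℚ` at ANY odd good ordinary prime `p` split in the imaginary quadratic `K`, for every
anticyclotomic `ℤ_p`-extension — including the anomalous primes (`a_p ≡ 1 (mod p)`, `E(ℚ_p)[p] ≠ 0`),
which are exactly the classes where hypothesis (iv) of the engine failed.

Argument (ours; the ingredients are Greenberg LNM 1716 §2 p. 70 and the local norm residue symbol of
`π²/p^h`, Jetchev–Skinner–Wan 2017 Prop. 3.3.4 Case 3(b)).  Let `C = Ê[p^∞]` be Greenberg's reduction
line (`reductionDatum`, character `χ_p·φ⁻¹`, quotient `E[p^∞]/C` unramified with Frobenius `α`, the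
unit root of `X² − a_pX + p`), and `σ₀ ∈ D_𝔭 ⊓ ker κ` the norm residue symbol of `π²/p^h`
(`𝔭^h = (π)`; Frobenius degree `h`, `χ_p(σ₀)·φ(π)² = p^{2h}`; tree theorem
`ZpExtension.exists_isFrobPow_mem_kerSubgroup_of_isAnticyclotomic_holds`).  Then `σ₀` acts on `C` by
`u₁ = χ_p(σ₀)α^{-h}` and on `E[p^∞]/C` by `u₂ = α^h`; `u₁ ≠ 1` by the weight obstruction
(`ne_of_unitRoot_of_span_eq_pow`: `α^h φ(π)² ≠ p^{2h}`) and `u₂ ≠ 1` because `X² − a_pX + p` has no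
rational root (Hasse, `a_p² < 4p`).  With `p^a ∥ (u₂ − 1)`-bound `a` and `p^b`-bound `b` for `u₁ − 1`,
every `σ₀`-fixed point of `E[p^∞]` is killed by `p^{a+b}` (§3), so the tower torsion is finite (§4).

* §1 two arithmetic lemmas (gcd with a prime power; non-divisibility read through `ℤ → ℤ_p`);
* §2 `unitRoot_pow_ne_one` — `α^h ≠ 1` for `h ≥ 1` (Hasse bound `DeuringLadic.frobeniusTrace_sq_le`);
* §3 `pow_smul_eq_zero_of_smul_eq` — the `ℚ`-side core: a point of `E[p^∞](ℚ̄)` fixed by an element of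
  Frobenius degree `n` with `χ_p ≢ α^n (p^{b+1})`, `α^n ≢ 1 (p^{a+1})` is killed by `p^{a+b}`;
* §4 `localTowerTorsionFiniteAt_baseChange_of_goodOrdinary` — Fin_v at `(E_K, p, κ, 𝔭)`, transported
  to `(K̄, D_𝔭)` along `…X3LineCharacterBaseChange` / `…X3LocalGaloisDegreeOne`.

Proofs only (no definition, no named fact, no `sorry`); helper for stmt-BirchSwinnertonDyer-26975
(`--supports`); closes nothing by itself; BSD is not advanced.  References: [GreenbergLNM1716] §2
p. 70; [JetchevSkinnerWan2017] §3.3 Prop. 3.3.4 Case 3(b); [GreenbergVatsal2000] §2 p. 26;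
[SilvermanAEC2009] V.2.3.1, V.1.1 (Hasse).
-/

noncomputable section

open scoped Classical

namespace Summit.BirchSwinnertonDyer.BirchSwinnertonDyer.Theorems.UniversalToricDescentTwinLocalTower

open NumberField IsDedekindDomain Field WeierstrassCurve
  Literature.NumberTheory.EllipticCurves Literature.NumberTheory.EllipticCurves.GreenbergSelmer
  Literature.NumberTheory.GaloisRepresentations Literature.NumberTheory.Automorphic
  Summit.BirchSwinnertonDyer.Rank1Residual.X11b
  Summit.BirchSwinnertonDyer.Rank1Residual.X2.GreenbergVatsalReductionDatum
  Summit.BirchSwinnertonDyer.Rank1Residual.X2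
  Summit.Ventures.HodgeRepro2.T5DegreeOneNumberField
  Summit.BirchSwinnertonDyer.BirchSwinnertonDyer.Theorems.SchneiderFreeAdditiveX3
open WeierstrassCurve (minimalDiscriminantInt)

set_option linter.dupNamespace false

/-! ## §1. Two arithmetic lemmas -/

/-- If `p^k • m = 0` and `z • m = 0` with `p^{e+1} ∤ z`, then `p^e • m = 0` (the gcd of `z` and `p^k`
is a power `p^j` with `j ≤ e`, and it kills `m` by Bézout). [folklore] -/
theorem pow_smul_eq_zero_of_zsmul_eq_zero {M : Type*} [AddCommGroup M] {p : ℕ} (hp : p.Prime)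
    {m : M} {k e : ℕ} (hk : p ^ k • m = 0) {z : ℤ} (hz : z • m = 0)
    (hnd : ¬ (p : ℤ) ^ (e + 1) ∣ z) : p ^ e • m = 0 := by
  set g : ℕ := Int.gcd z ((p : ℤ) ^ k) with hg
  have hpk : ((p : ℤ) ^ k) • m = 0 := by
    rw [show ((p : ℤ) ^ k) = ((p ^ k : ℕ) : ℤ) by push_cast; rfl, natCast_zsmul, hk]
  have hgm : (g : ℤ) • m = 0 := by
    rw [hg, Int.gcd_eq_gcd_ab, add_smul, mul_comm z, mul_smul, hz, smul_zero, zero_add, mul_comm,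
      mul_smul, hpk, smul_zero]
  have hgdvd : g ∣ p ^ k := by
    have h1 : (g : ℤ) ∣ (p : ℤ) ^ k := hg ▸ Int.gcd_dvd_right ..
    rw [show ((p : ℤ) ^ k) = ((p ^ k : ℕ) : ℤ) by push_cast; rfl] at h1
    exact Int.natCast_dvd_natCast.mp h1
  obtain ⟨j, -, hj⟩ := (Nat.dvd_prime_pow hp).mp hgdvd
  have hjz : (p : ℤ) ^ j ∣ z := by
    have h1 : (g : ℤ) ∣ z := hg ▸ Int.gcd_dvd_left ..
    rw [hj] at h1; push_cast at h1; exact h1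
  have hje : j ≤ e := by
    by_contra hlt
    exact hnd (dvd_trans (pow_dvd_pow (p : ℤ) (by omega)) hjz)
  have hjm : p ^ j • m = 0 := by rw [← natCast_zsmul, ← hj]; exact hgm
  obtain ⟨d, hd⟩ := Nat.exists_eq_add_of_le hje
  rw [hd, add_comm, pow_add, mul_smul, hjm, smul_zero]

/-- A nonzero `p`-adic integer lies outside some `p^{e+1} ℤ_p`. [folklore] -/
theorem exists_not_mem_span_pow {p : ℕ} [hp : Fact p.Prime] {x : ℤ_[p]} (hx : x ≠ 0) :
    ∃ e : ℕ, x ∉ (Ideal.span {(p : ℤ_[p]) ^ (e + 1)} : Ideal ℤ_[p]) := by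
  obtain ⟨e, he⟩ := PadicInt.exists_pow_neg_lt p (norm_pos_iff.mpr hx)
  refine ⟨e, fun hmem ↦ ?_⟩
  rw [← PadicInt.norm_le_pow_iff_mem_span_pow] at hmem
  have hle : (p : ℝ) ^ (-((e + 1 : ℕ) : ℤ)) ≤ (p : ℝ) ^ (-(e : ℤ)) :=
    zpow_le_zpow_right₀ (by exact_mod_cast hp.out.one_lt.le) (by push_cast; omega)
  linarith

/-- Non-divisibility read through `ℤ → ℤ_p`: if `w ∉ p^{e+1}ℤ_p` and `z ≡ w (mod p^k)` with
`k ≥ e + 1`, then `p^{e+1} ∤ z`. [folklore] -/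
theorem not_pow_dvd_of_sub_mem_span {p : ℕ} [Fact p.Prime] {w : ℤ_[p]} {z : ℤ} {e k : ℕ}
    (hk : e + 1 ≤ k) (hw : w ∉ (Ideal.span {(p : ℤ_[p]) ^ (e + 1)} : Ideal ℤ_[p]))
    (hz : (z : ℤ_[p]) - w ∈ (Ideal.span {(p : ℤ_[p]) ^ k} : Ideal ℤ_[p])) :
    ¬ (p : ℤ) ^ (e + 1) ∣ z := by
  rintro ⟨c, hc⟩
  apply hw
  have hzmem : (z : ℤ_[p]) ∈ (Ideal.span {(p : ℤ_[p]) ^ (e + 1)} : Ideal ℤ_[p]) := by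
    rw [hc]; push_cast
    exact Ideal.mul_mem_right _ _ (Ideal.mem_span_singleton_self _)
  have hle : (Ideal.span {(p : ℤ_[p]) ^ k} : Ideal ℤ_[p]) ≤ Ideal.span {(p : ℤ_[p]) ^ (e + 1)} :=
    Ideal.span_singleton_le_span_singleton.mpr (pow_dvd_pow _ hk)
  have h := sub_mem hzmem (hle hz)
  rwa [sub_sub_cancel] at h

/-! ## §2. The unit root is not a root of unity -/

/-- **`α^h ≠ 1` for the unit root `α` of `X² − a_p X + p` and every `h ≥ 1`** (`E/ℚ` globally minimal,
`p ∤ Δ_E`, `p ∤ a_p`).  If `α^h = 1` then `β = a_p − α` has `β^h = p^h`; writing `α^h = rα + s`,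
`β^h = rβ + s` (`r, s ∈ ℤ`), either `r = 0` and `1 = s = p^h`, or `t = 1 − s = rα` satisfies
`t² − a_p r t + p r² = 0` in `ℤ` with `r ≠ 0` — impossible since `a_p² < 4p` (Hasse) makes the form
positive definite. [cite: SilvermanAEC2009, Thm. V.1.1 (Hasse), V.2.3.1] -/
theorem unitRoot_pow_ne_one (W : WeierstrassCurve ℚ) [W.IsElliptic] [W.IsGloballyMinimal] (p : ℕ)
    [hp : Fact p.Prime] (hΔ : ¬ (p : ℤ) ∣ minimalDiscriminantInt W)
    (hord : ¬ (p : ℤ) ∣ W.frobeniusTrace p) {h : ℕ} (hh : 0 < h) :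
    unitRoot W p ^ h ≠ 1 := by
  obtain ⟨hz, -⟩ := unitRoot_spec_holds W p ⟨W.hasGoodReductionAtPrime_of_not_dvd p hΔ, hord⟩
  set α : ℤ_[p] := unitRoot W p with hα
  set a : ℤ := W.frobeniusTrace p with ha
  -- Hasse: `a² < 4p` (equality would make `p` a square)
  have hle4 : a ^ 2 ≤ 4 * p := DeuringLadic.frobeniusTrace_sq_le W hp.out hΔ
  have hlt : a ^ 2 < 4 * (p : ℤ) := by
    refine lt_of_le_of_ne hle4 fun h4 ↦ ?_
    have h2a : (2 : ℤ) ∣ a := by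
      have : (2 : ℤ) ∣ a ^ 2 := ⟨2 * p, by rw [h4]; ring⟩
      exact Int.Prime.dvd_pow' Nat.prime_two this |> fun h ↦ by exact_mod_cast h
    obtain ⟨c, hc⟩ := h2a
    have hcp : c * c = (p : ℤ) := by
      have h4' : 4 * (c * c) = 4 * (p : ℤ) := by rw [← h4, hc]; ring
      linarith
    have hsq : IsSquare (p : ℤ) := ⟨c, hcp.symm⟩
    exact (Nat.prime_iff_prime_int.mp hp.out).not_isSquare hsq
  set β : ℤ_[p] := (a : ℤ_[p]) - α with hβ
  have hα2 : α ^ 2 = (a : ℤ_[p]) * α - p := by linear_combination hz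
  have hβ2 : β ^ 2 = (a : ℤ_[p]) * β - p := by rw [hβ]; linear_combination hz
  have hαβ : α * β = p := by rw [hβ]; linear_combination -hz
  -- `α^k = rα + s`, `β^k = rβ + s`
  have hpow : ∀ k : ℕ, ∃ r s : ℤ, α ^ k = r * α + s ∧ β ^ k = r * β + s := by
    intro k
    induction k with
    | zero => exact ⟨0, 1, by simp, by simp⟩
    | succ k ih =>
      obtain ⟨r, s, hr, hs⟩ := ih
      refine ⟨r * a + s, -(r * p), ?_, ?_⟩
      · rw [pow_succ, hr]; push_cast; linear_combination (r : ℤ_[p]) * hα2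
      · rw [pow_succ, hs]; push_cast; linear_combination (r : ℤ_[p]) * hβ2
  intro hαh
  obtain ⟨r, s, hr, hs⟩ := hpow h
  have hβh : β ^ h = (p : ℤ_[p]) ^ h := by
    have h1 : α ^ h * β ^ h = (p : ℤ_[p]) ^ h := by rw [← mul_pow, hαβ]
    rwa [hαh, one_mul] at h1
  rw [hαh] at hr
  rw [hβh] at hs
  by_cases hr0 : r = 0
  · rw [hr0] at hr hs
    push_cast at hr hs
    rw [zero_mul, zero_add] at hr hs
    -- `1 = s = p^h` in `ℤ_p`, hence in `ℤ`
    have h1 : ((1 : ℤ) : ℤ_[p]) = ((p ^ h : ℕ) : ℤ) := by push_cast; rw [hr, ← hs]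
    have h2 : (1 : ℤ) = (p : ℤ) ^ h := by exact_mod_cast Int.cast_injective h1
    have h3 : 1 < (p : ℤ) ^ h := one_lt_pow₀ (by exact_mod_cast hp.out.one_lt) hh.ne'
    omega
  · -- `t = 1 - s = rα`, and `t² − a r t + p r² = r²(α² − aα + p) = 0`
    have ht : ((1 - s : ℤ) : ℤ_[p]) = r * α := by push_cast; linear_combination hr
    have hrel : (((1 - s) ^ 2 - a * r * (1 - s) + p * r ^ 2 : ℤ) : ℤ_[p]) = 0 := by
      have e1 : (((1 - s) ^ 2 - a * r * (1 - s) + p * r ^ 2 : ℤ) : ℤ_[p]) =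
          ((1 - s : ℤ) : ℤ_[p]) ^ 2 - a * r * ((1 - s : ℤ) : ℤ_[p]) + p * r ^ 2 := by push_cast; ring
      rw [e1, ht]
      linear_combination (r : ℤ_[p]) ^ 2 * hz
    have hZ : (1 - s) ^ 2 - a * r * (1 - s) + p * r ^ 2 = (0 : ℤ) := by
      exact_mod_cast (Int.cast_injective (α := ℤ_[p])) (by rw [hrel]; push_cast; rfl)
    have hr2 : 0 < r ^ 2 := lt_of_le_of_ne (sq_nonneg r) (Ne.symm (pow_ne_zero 2 hr0))
    nlinarith [sq_nonneg (2 * (1 - s) - a * r), hZ, hr2, hlt]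

/-! ## §3. The `ℚ`-side core: a fixed point of an element of Frobenius degree `n` is killed by `p^{a+b}` -/

section Core

variable (W : WeierstrassCurve ℚ) [W.IsGloballyMinimal] [W.IsElliptic] (p : ℕ) [hp : Fact p.Prime]
  {v : HeightOneSpectrum (𝓞 ℚ)}

/-- **Core of Fin_v at a good ordinary prime (`ℚ`-side).**  `E/ℚ` globally minimal, `p ∤ Δ_E`,
`p ∤ a_p`, `v ∋ p`, `α = unitRoot W p`; `σ ∈ Γ_{ℚ_v}` of Frobenius degree `n` with
`α^n − 1 ∉ p^{a+1}ℤ_p` and `χ_p(res σ) − α^n ∉ p^{b+1}ℤ_p`.  Then every `m ∈ E[p^∞](ℚ̄)` with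
`res σ • m = m` satisfies `p^{a+b} • m = 0`.  Proof: `res σ` acts on `E[p^∞]/C_v` as `α^n`
(`reductionDatum_smul_sub_mem_of_isFrobPow`), so `y = (1 − M) • m ∈ C_v` with `M ≡ α^n (p^k)`; on
`C_v` it acts as `N ≡ χ_p α^{-n} (p^k)` (`reductionDatum_smul_eq_of_isFrobPow`), so `(N − 1) • y = 0`;
and `p^{b+1} ∤ N − 1`, `p^{a+1} ∤ 1 − M`, whence `p^b • y = 0` and `p^{a+b} • m = 0` (§1).
[cite: GreenbergLNM1716, §2 p. 70 (after Prop. 2.4)] -/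
theorem pow_smul_eq_zero_of_smul_eq (hpv : ((p : ℕ) : 𝓞 ℚ) ∈ v.asIdeal)
    (hΔ : ¬ (p : ℤ) ∣ minimalDiscriminantInt W) (hord : ¬ (p : ℤ) ∣ W.frobeniusTrace p)
    {σ : absoluteGaloisGroup (v.adicCompletion ℚ)} {n : ℕ} (hσ : IsFrobPow σ (n : ℤ)) {a b : ℕ}
    (hu₂ : unitRoot W p ^ n - 1 ∉ (Ideal.span {(p : ℤ_[p]) ^ (a + 1)} : Ideal ℤ_[p]))
    (hu₁ : ((GaloisRep.cyclotomicCharacter ℚ p (absGaloisRestrict ℚ (v.adicCompletion ℚ) σ) :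
        ℤ_[p]ˣ) : ℤ_[p]) - unitRoot W p ^ n ∉ (Ideal.span {(p : ℤ_[p]) ^ (b + 1)} : Ideal ℤ_[p]))
    (m : W.geomPrimaryTorsion p) (hm : absGaloisRestrict ℚ (v.adicCompletion ℚ) σ • m = m) :
    p ^ (a + b) • m = 0 := by
  obtain ⟨-, hzu⟩ := unitRoot_spec_holds W p ⟨W.hasGoodReductionAtPrime_of_not_dvd p hΔ, hord⟩
  set α : ℤ_[p] := unitRoot W p with hα
  set αu : ℤ_[p]ˣ := hzu.unit with hαu
  have hαuv : (αu : ℤ_[p]) = α := hzu.unit_spec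
  set ρ := absGaloisRestrict ℚ (v.adicCompletion ℚ) σ with hρ
  set χ : ℤ_[p] := ((GaloisRep.cyclotomicCharacter ℚ p ρ : ℤ_[p]ˣ) : ℤ_[p]) with hχ
  have hαinv : ((αu⁻¹ ^ n : ℤ_[p]ˣ) : ℤ_[p]) * α ^ n = 1 := by
    rw [← hαuv, ← Units.val_pow_eq_pow_val, ← Units.val_mul, ← mul_pow, inv_mul_cancel, one_pow,
      Units.val_one]
  -- an exponent `k ≥ a + 1, b + 1` killing `m`
  obtain ⟨k₀, hk₀⟩ : ∃ k₀ : ℕ, p ^ k₀ • m = 0 := by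
    obtain ⟨k, hk⟩ := m.2
    exact ⟨k, Subtype.ext (by rw [AddSubgroupClass.coe_nsmul, hk]; rfl)⟩
  set k := k₀ + (a + b + 2) with hk
  have hmk : p ^ k • m = 0 := by rw [hk, pow_add, mul_comm, mul_smul, hk₀, smul_zero]
  have hka : a + 1 ≤ k := by omega
  have hkb : b + 1 ≤ k := by omega
  -- quotient step: `y = m − M • m ∈ C_v`, `M ≡ α^n (mod p^k)`
  set M : ℕ := (PadicInt.toZModPow k (α ^ n)).val with hM
  have hquot := reductionDatum_smul_sub_mem_of_isFrobPow W p hpv hΔ hord hσ k m hmk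
  rw [hm] at hquot
  set y : W.geomPrimaryTorsion p := m - M • m with hy
  have hyC : y ∈ (reductionDatum W p hpv hΔ).plus := hquot
  have hyz : y = (1 - (M : ℤ)) • m := by rw [hy, sub_smul, one_smul, natCast_zsmul]
  have hyk : p ^ k • y = 0 := by rw [hyz, smul_comm, hmk, smul_zero]
  have hρy : ρ • y = y := by
    have h1 : ρ • (M • m) = M • (ρ • m) :=
      map_nsmul (DistribSMul.toAddMonoidHom (W.geomPrimaryTorsion p) ρ) M m
    rw [hy, smul_sub, h1, hm]
  -- line step: `res σ • y = N • y`, `N ≡ χ α^{-n} (mod p^k)`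
  set N : ℤ := ((PadicInt.toZModPow k (χ * ((αu⁻¹ ^ n : ℤ_[p]ˣ) : ℤ_[p]))).val : ℤ) with hN
  have hN0 : (N : ℤ_[p]) - χ * ((αu⁻¹ ^ n : ℤ_[p]ˣ) : ℤ_[p]) ∈
      (Ideal.span {(p : ℤ_[p]) ^ k} : Ideal ℤ_[p]) := by
    rw [← PadicInt.ker_toZModPow, RingHom.mem_ker, map_sub, hN, map_intCast, Int.cast_natCast,
      ZMod.natCast_zmod_val, sub_self]
  have hN' : (N : ℤ_[p]) * unitRoot W p ^ n - χ ∈ (Ideal.span {(p : ℤ_[p]) ^ k} : Ideal ℤ_[p]) := by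
    have h1 := Ideal.mul_mem_right (α ^ n) _ hN0
    have key : ((N : ℤ_[p]) - χ * ((αu⁻¹ ^ n : ℤ_[p]ˣ) : ℤ_[p])) * α ^ n = (N : ℤ_[p]) * α ^ n - χ := by
      rw [sub_mul, mul_assoc, hαinv, mul_one]
    rwa [key] at h1
  have hline := reductionDatum_smul_eq_of_isFrobPow W p hpv hΔ hord hσ k y hyC hyk N hN'
  rw [hρy] at hline
  have hz₁ : (N - 1) • y = 0 := by rw [sub_smul, one_smul, ← hline, sub_self]
  -- the two non-divisibilities
  have hnd₁ : ¬ (p : ℤ) ^ (b + 1) ∣ (N - 1) := by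
    refine not_pow_dvd_of_sub_mem_span hkb (w := χ * ((αu⁻¹ ^ n : ℤ_[p]ˣ) : ℤ_[p]) - 1) ?_ ?_
    · intro hw
      apply hu₁
      have h1 := Ideal.mul_mem_right (α ^ n) _ hw
      have key : (χ * ((αu⁻¹ ^ n : ℤ_[p]ˣ) : ℤ_[p]) - 1) * α ^ n = χ - unitRoot W p ^ n := by
        rw [sub_mul, one_mul, mul_assoc, hαinv, mul_one]
      rwa [key] at h1
    · have e1 : (((N - 1 : ℤ)) : ℤ_[p]) - (χ * ((αu⁻¹ ^ n : ℤ_[p]ˣ) : ℤ_[p]) - 1) =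
          (N : ℤ_[p]) - χ * ((αu⁻¹ ^ n : ℤ_[p]ˣ) : ℤ_[p]) := by push_cast; ring
      rw [e1]; exact hN0
  have hnd₂ : ¬ (p : ℤ) ^ (a + 1) ∣ (1 - (M : ℤ)) := by
    refine not_pow_dvd_of_sub_mem_span hka (w := 1 - α ^ n) ?_ ?_
    · intro hw
      apply hu₂
      rw [← neg_sub]
      exact neg_mem hw
    · have e1 : (((1 - (M : ℤ) : ℤ)) : ℤ_[p]) - (1 - α ^ n) = α ^ n - (M : ℤ_[p]) := by
        push_cast; ring
      rw [e1, ← PadicInt.ker_toZModPow, RingHom.mem_ker, map_sub, map_natCast, hM,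
        ZMod.natCast_zmod_val, sub_self]
  -- conclusion: §1 twice
  have step1 : p ^ b • y = 0 := pow_smul_eq_zero_of_zsmul_eq_zero hp.out hyk hz₁ hnd₁
  rw [hyz, smul_comm (p ^ b) (1 - (M : ℤ)) m] at step1
  have hk' : p ^ k • (p ^ b • m) = 0 := by rw [smul_comm, hmk, smul_zero]
  have step2 : p ^ a • (p ^ b • m) = 0 := pow_smul_eq_zero_of_zsmul_eq_zero hp.out hk' step1 hnd₂
  rwa [← mul_smul, ← pow_add] at step2

end Core

/-! ## §4. Fin_v for a good ordinary `E/ℚ` at `(E_K, p, κ, 𝔭)` -/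

section Main

variable (W : WeierstrassCurve ℚ) [W.IsGloballyMinimal] [W.IsElliptic] {p : ℕ} [hp : Fact p.Prime]
  {K : Type} [Field K] [NumberField K]

/-- **Fin_v for a GOOD ORDINARY curve on the anticyclotomic tower at a split prime.**  `E/ℚ`
globally minimal, `p` odd with `p ∤ Δ_E`, `p ∤ a_p` (good ordinary — anomalous primes allowed), `K`
imaginary quadratic with `p` split, `κ` an anticyclotomic `ℤ_p`-extension, `𝔭 ∣ p`.  Then
`E(K̄)[p^∞]^{D_𝔭 ⊓ Gal(K̄/K_∞)} = E(K_{∞,w})[p^∞]` is finite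
(`SchneiderFreeControlAtoms.LocalTowerTorsionFiniteAt (W.baseChange K) p κ 𝔭`): the norm residue
symbol `σ₀` of `π²/p^h` (`ZpExtension.exists_isFrobPow_mem_kerSubgroup_of_isAnticyclotomic_holds`:
Frobenius degree `h`, fixes `K_∞`, `χ_p(σ₀)φ(π)² = p^{2h}`) acts on Greenberg's line by
`χ_p(σ₀)α^{-h} ≠ 1` (weight: `ne_of_unitRoot_of_span_eq_pow`) and on the étale quotient by
`α^h ≠ 1` (`unitRoot_pow_ne_one`), so by §3 (transported from `(ℚ̄, D_v)` to `(K̄, D_𝔭)` at degree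
one) the tower torsion lies in `E_K[p^{a+b}]`, a finite set.
[cite: JetchevSkinnerWan2017, §3.3 Prop. 3.3.4 Case 3(b) (arXiv:1512.06894 p. 13)]
[cite: GreenbergLNM1716, §2 p. 70 (after Prop. 2.4)] -/
theorem localTowerTorsionFiniteAt_baseChange_of_goodOrdinary (hp2 : p ≠ 2)
    (hΔ : ¬ (p : ℤ) ∣ minimalDiscriminantInt W) (hord : ¬ (p : ℤ) ∣ W.frobeniusTrace p)
    (hK : IsImaginaryQuadratic K) (hsplit : SplitsIn K p) (κ : ZpExtension K p)
    (hκ : κ.IsAnticyclotomic) (𝔭 : HeightOneSpectrum (𝓞 K)) (h𝔭 : ((p : ℕ) : 𝓞 K) ∈ 𝔭.asIdeal) :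
    SchneiderFreeControlAtoms.LocalTowerTorsionFiniteAt (W.baseChange K) p κ 𝔭 := by
  have h2 : Module.finrank ℚ K = 2 := hK.1
  set v : HeightOneSpectrum (𝓞 ℚ) := ratPlace p with hv
  have hpv : ((p : ℕ) : 𝓞 ℚ) ∈ v.asIdeal :=
    (natCast_mem_asIdeal_iff_eq_primesEquiv_symm v hp.out).mpr rfl
  haveI := liesOver_of_natCast_mem hpv h𝔭
  obtain ⟨he, hf⟩ := degreeOne_of_splitsIn h2 hsplit h𝔭
  haveI := liesOver_span_of_natCast_mem (K := K) h𝔭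
  have hdeg := ramificationIdx_mul_inertiaDeg_eq_one_of_splitsIn h2 hsplit h𝔭
  obtain ⟨h, π, hh, hπ⟩ := exists_pow_eq_span_singleton 𝔭
  obtain ⟨σ₀, hfrob, hker, hcyc⟩ :=
    ZpExtension.exists_isFrobPow_mem_kerSubgroup_of_isAnticyclotomic_holds K p hK hp2 𝔭 h𝔭 he hf
      h π hh hπ
  -- the transport `(ℚ̄, D_v) → (K̄, D_𝔭)`
  letI := (adicCompletionOfLiesOver ℚ K v 𝔭).toAlgebra
  obtain ⟨τ, hτc⟩ := exists_absGaloisRestrict_adicCompletion_conj K v 𝔭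
  set Φ := absGaloisRestrict (v.adicCompletion ℚ) (𝔭.adicCompletion K) with hΦ
  set e := primaryBaseChangeEquiv K W p with he_def
  set g := absGaloisRestrict K (𝔭.adicCompletion K) σ₀ with hg
  set ρ := absGaloisRestrict ℚ (v.adicCompletion ℚ) (Φ σ₀) with hρ
  have hkey : ∀ m : W.geomPrimaryTorsion p, g • e (τ • m) = e (τ • (ρ • m)) := fun m ↦
    absGaloisRestrict_smul_primaryBaseChangeEquiv_smul W K v 𝔭 hτc σ₀ m
  have hρfrob : IsFrobPow (Φ σ₀) (h : ℤ) :=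
    isFrobPow_absGaloisRestrict_adicCompletion_of_inertiaDeg_eq_one K v 𝔭 hf hfrob
  have hχ : GaloisRep.cyclotomicCharacter K p g = GaloisRep.cyclotomicCharacter ℚ p ρ :=
    cyclotomicCharacter_adicCompletion_eq_of_conj K v 𝔭 p hτc σ₀
  -- the unit root and the two exponents
  obtain ⟨hz, -⟩ := unitRoot_spec_holds W p ⟨W.hasGoodReductionAtPrime_of_not_dvd p hΔ, hord⟩
  set α : ℤ_[p] := unitRoot W p with hα
  obtain ⟨a, ha⟩ := exists_not_mem_span_pow (sub_ne_zero.mpr (unitRoot_pow_ne_one W p hΔ hord hh))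
  have hne : ((GaloisRep.cyclotomicCharacter ℚ p ρ : ℤ_[p]ˣ) : ℤ_[p]) - α ^ h ≠ 0 := by
    rw [← hχ]
    intro h0
    have hεα : ((GaloisRep.cyclotomicCharacter K p g : ℤ_[p]ˣ) : ℤ_[p]) = α ^ h := sub_eq_zero.mp h0
    -- `χ_p(σ₀) φ(π)² = p^{2h}`, so `α^h φ(π)² = p^{2h}`: excluded by the weight
    have hB := mul_sq_eq_of_congruences (p := p) 𝔭 hdeg hπ hcyc
    rw [hεα] at hB
    have hN : Ideal.absNorm 𝔭.asIdeal = p := by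
      rw [Ideal.absNorm_apply, Submodule.cardQuot_apply, ← pow_one 𝔭.asIdeal,
        natCard_quot_pow' 𝔭 p hdeg 1, pow_one]
    set φ := integersToPadicInt 𝔭 p hdeg with hφ
    have hφ' : Function.Injective ((PadicInt.Coe.ringHom (p := p)).comp φ) :=
      (Subtype.val_injective).comp (integersToPadicInt_injective 𝔭 p hdeg)
    have hα2 : α ^ 2 = (W.frobeniusTrace p : ℤ_[p]) * α - p := by linear_combination hz
    refine ne_of_unitRoot_of_span_eq_pow (R := ℚ_[p]) h2 𝔭.isPrime hp.out hN h𝔭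
      (natCast_notMem_sq 𝔭 p hdeg) hh hπ ((PadicInt.Coe.ringHom (p := p)).comp φ) hφ'
      (a := W.frobeniusTrace p) (α := ((α : ℤ_[p]) : ℚ_[p]))
      (by have := congrArg (fun z : ℤ_[p] ↦ (z : ℚ_[p])) hα2; simpa using this)
      (s := 1) (Or.inl rfl) ?_
    have := congrArg (fun z : ℤ_[p] ↦ (z : ℚ_[p])) hB
    simpa using this
  obtain ⟨b, hb⟩ := exists_not_mem_span_pow hne
  -- every point fixed by `D_𝔭 ⊓ ker κ` is killed by `p^{a+b}`
  refine (AcSelmer.finite_setOf_geomPrimaryTorsion_pow_smul_eq_zero (W.baseChange K)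
    hp.out.ne_zero (a + b)).subset fun x hx ↦ ?_
  have hgmem : g ∈ decomp 𝔭 ⊓ κ.kerSubgroup :=
    Subgroup.mem_inf.mpr ⟨(mem_decomp_iff 𝔭 g).mpr ⟨σ₀, rfl⟩, hker κ hκ⟩
  have hgx : g • x = x := (FixedPoints.mem_addSubgroup _ _ x).mp hx ⟨g, hgmem⟩
  set m : W.geomPrimaryTorsion p := τ⁻¹ • e.symm x with hm
  have hxm : x = e (τ • m) := by rw [hm, smul_inv_smul, AddEquiv.apply_symm_apply]
  have hρm : ρ • m = m := by
    have h1 : e (τ • (ρ • m)) = e (τ • m) := by rw [← hkey m, ← hxm, hgx]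
    exact MulAction.injective τ (e.injective h1)
  have hkill : p ^ (a + b) • m = 0 :=
    pow_smul_eq_zero_of_smul_eq W p hpv hΔ hord hρfrob ha hb m hρm
  have h3 : τ • (p ^ (a + b) • m) = p ^ (a + b) • (τ • m) :=
    map_nsmul (DistribSMul.toAddMonoidHom (W.geomPrimaryTorsion p) τ) _ m
  show p ^ (a + b) • x = 0
  rw [hxm, ← map_nsmul, ← h3, hkill, smul_zero, map_zero]

end Main

end Summit.BirchSwinnertonDyer.BirchSwinnertonDyer.Theorems.UniversalToricDescentTwinLocalTower

end
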